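import Summits.BirchSwinnertonDyer.BirchSwinnertonDyer.Theorems.KolyvaginRankRigidityAtTwoEigenTransfer
import HarnessLib

/-!
# Crux V2 `KolyvaginCorankRigidityAtTwo` (stmt-BirchSwinnertonDyer-23949), line `kolyvagin-depth-split`,
# stub `stub_lowerBoundMinimalPosDepth`, step (S2): an upper-TRIANGULAR localisation matrix with
# large diagonal makes the classes span a large subgroup

Kolyvagin 1991 (Math. Ann. 291), proof of Thm. 2.2: "We set `R_{ij} = φ_{p_{f+j}}(η_i)`. Then
`R_{ij} = 0` for `j < i` … `R_{ii} ∈ ℓ^{m_f}(ℤ/M)^*`. If `Σ α_i η_i = 0`, then by applying to this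
identity the characters `ψ_{p_{f+j}}` for `j = 1, …, f+1` we obtain that `α_i ≡ 0`"; W. Zhang 2014,
Lemma 8.4 (2): "the `(ν+1)×(ν+1)`-matrix `(loc_{ℓ_{ν+j}}(c(n_i)))` is invertible and upper
triangular". The pure algebra of that step, with a DEFECT allowed on the diagonal (orders
`≥ m` instead of units — the form needed at `p = 2`, where each local pairing loses a bit):

* `pow_le_natCard_closure_of_triangular` — elements `η_0, …, η_{k-1}` of an abelian group and
  additive maps `φ_0, …, φ_{k-1}` to an abelian group `Q` with `φ_j(η_i) = 0` for `j < i` and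
  `addOrderOf (φ_i(η_i)) ≥ m` generate a (finite) subgroup of order `≥ m^k`.

With the landed (S3) `lowerBound_of_eigenGrowthOverK` (p596499) and (S4)
`le_selmerCorank_of_pow_le_natCard` (p595706) this completes the FORMAL half of the stub: what
remains is the existence of the triangular system of Kolyvagin classes at `2` (Čebotarev one
level up, Kolyvagin's formula `loc_ℓ c(nℓ) = ψ_ℓ loc_ℓ c(n)`, reciprocity) — the research content.
HONEST FRAMING: pure algebra; BSD is not proved; the stub stays open.
-/

set_option autoImplicit false
-- the Theorems namespace of this sub repeats the summit name by design (D-0017 nested layout)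
set_option linter.dupNamespace false

namespace Summit.BirchSwinnertonDyer.BirchSwinnertonDyer.Theorems.KolyvaginRankRigidity

open AddSubgroup

variable {B Q : Type*} [AddCommGroup B] [AddCommGroup Q]

/-- `#H = #im ψ · #ker ψ` for `ψ : H → Q` with `H` finite: the counting identity used at each
step of the triangular induction. [folklore] -/
private theorem natCard_eq_range_mul_ker {H : Type*} [AddCommGroup H] (ψ : H →+ Q) :
    Nat.card H = Nat.card ψ.range * Nat.card ψ.ker := by
  rw [card_eq_card_quotient_mul_card_addSubgroup ψ.ker,
    Nat.card_congr (QuotientAddGroup.quotientKerEquivRange ψ).toEquiv]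

/-- **Triangular independence with defect.** Let `η : Fin k → B`, `φ : Fin k → (B →+ Q)` with
`φ j (η i) = 0` whenever `j < i` (upper-triangular matrix `(φ_j(η_i))`) and every diagonal
entry `φ i (η i)` of additive order at least `m`. If the subgroup `H` generated by the `η i` is
finite, then `m ^ k ≤ #H`. (Induction on `k`: `φ_0` kills `η_1, …, η_{k-1}`, so
`#H = #φ_0(H) · #(H ∩ ker φ_0) ≥ ord(φ_0 η_0) · #⟨η_1, …⟩`.) Kolyvagin 1991, proof of Thm. 2.2;
W. Zhang 2014, Lemma 8.4 (2). [cite: Kolyvagin1991MathAnn, §2, proof of Thm. 2.2] -/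
theorem pow_le_natCard_closure_of_triangular (m : ℕ) :
    ∀ (k : ℕ) (η : Fin k → B) (φ : Fin k → (B →+ Q)),
      Finite (closure (Set.range η)) →
      (∀ i j : Fin k, j < i → φ j (η i) = 0) →
      (∀ i : Fin k, m ≤ addOrderOf (φ i (η i))) →
      m ^ k ≤ Nat.card (closure (Set.range η)) := by
  intro k
  induction k with
  | zero =>
    intro η φ hfin _ _
    haveI := hfin
    rw [pow_zero]
    exact Nat.one_le_iff_ne_zero.mpr (Nat.card_pos (α := closure (Set.range η))).ne'
  | succ k ih =>
    intro η φ hfin htri hdiag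
    haveI := hfin
    set H : AddSubgroup B := closure (Set.range η) with hH
    -- the tail system
    set η' : Fin k → B := fun i ↦ η i.succ with hη'
    set φ' : Fin k → (B →+ Q) := fun i ↦ φ i.succ with hφ'
    set H' : AddSubgroup B := closure (Set.range η') with hH'
    have hle : H' ≤ H := closure_mono (by
      rintro _ ⟨i, rfl⟩
      exact ⟨i.succ, rfl⟩)
    haveI : Finite H' := Finite.of_injective _ (inclusion_injective hle)
    have htri' : ∀ i j : Fin k, j < i → φ' j (η' i) = 0 := fun i j hij ↦
      htri i.succ j.succ (Fin.succ_lt_succ_iff.mpr hij)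
    have hdiag' : ∀ i : Fin k, m ≤ addOrderOf (φ' i (η' i)) := fun i ↦ hdiag i.succ
    have hIH : m ^ k ≤ Nat.card H' := ih η' φ' inferInstance htri' hdiag'
    -- `φ 0` restricted to `H`
    set ψ : H →+ Q := (φ 0).comp H.subtype with hψ
    -- `H' ⊆ ker ψ`: `φ 0` kills `η i.succ`
    have hker : ∀ x ∈ H', φ 0 x = 0 := by
      intro x hx
      refine closure_induction (fun y hy ↦ ?_) (map_zero _) (fun a b _ _ ha hb ↦ ?_)
        (fun a _ ha ↦ ?_) hx
      · obtain ⟨i, rfl⟩ := hy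
        exact htri i.succ 0 (Fin.succ_pos i)
      · rw [map_add, ha, hb, add_zero]
      · rw [map_neg, ha, neg_zero]
    have hker_card : Nat.card H' ≤ Nat.card ψ.ker := by
      refine Nat.card_le_card_of_injective
        (fun x : H' ↦ (⟨⟨(x : B), hle x.2⟩, ?_⟩ : ψ.ker)) ?_
      · rw [AddMonoidHom.mem_ker]
        exact hker _ x.2
      · intro x y hxy
        exact Subtype.ext (congrArg (fun z : ψ.ker ↦ ((z : H) : B)) hxy)
    -- `im ψ ⊇ ⟨φ 0 (η 0)⟩`, of order `≥ m`
    have hmem : η 0 ∈ H := subset_closure ⟨0, rfl⟩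
    have hrange_card : m ≤ Nat.card ψ.range := by
      haveI : Finite ψ.range := Finite.of_surjective _ ψ.rangeRestrict_surjective
      have hz : φ 0 (η 0) ∈ ψ.range := ⟨⟨η 0, hmem⟩, rfl⟩
      have hzle : zmultiples (φ 0 (η 0)) ≤ ψ.range := zmultiples_le.mpr hz
      calc m ≤ addOrderOf (φ 0 (η 0)) := hdiag 0
        _ = Nat.card (zmultiples (φ 0 (η 0))) := (Nat.card_zmultiples _).symm
        _ ≤ Nat.card ψ.range := card_le_of_le hzle
    calc m ^ (k + 1) = m * m ^ k := by ring
      _ ≤ Nat.card ψ.range * Nat.card ψ.ker :=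
          Nat.mul_le_mul hrange_card (hIH.trans hker_card)
      _ = Nat.card H := (natCard_eq_range_mul_ker ψ).symm


/-! ## The interface for the research stub: a triangular system over `K` at every level -/

section OverK

open scoped Classical AddSubgroup
open WeierstrassCurve Literature.NumberTheory.EllipticCurves

variable (W : WeierstrassCurve ℚ) [W.IsElliptic] (K : Type) [Field K] [NumberField K]
  (h2 : Module.finrank ℚ K = 2) {θ : K} {c : ℚ} (hθ : θ ∉ Set.range (algebraMap ℚ K))
  (hc : θ ^ 2 = algebraMap ℚ K c)

include h2 hθ hc in
/-- **A triangular system of level `M` in `Sel_{2^∞}(E/K)` spans a large finite eigen-subgroup.**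
Classes `η_0, …, η_{k-1} ∈ Sel_{2^∞}(E/K)` killed by `2^M`, eigenvectors of the conjugation
action with a common sign `ε` (`τ₀_* η_i = ε • η_i`), and additive maps `φ_0, …, φ_{k-1}` to an
abelian group `Q` (localisations at auxiliary Kolyvagin primes, then any functional) with
`φ_j(η_i) = 0` for `j < i` and `ord φ_i(η_i) ≥ 2^{M-d}` — the shape of Kolyvagin 1991 Thm. 2.2
(`η_i = τ_{p_0 p_i ⋯ p_{i+f-1}, n'}`, `R_{ij} = φ_{p_{f+j}}(η_i)`) with a defect `d` allowed for the
prime `2` — generate a finite subgroup `B ≤ Sel_{2^∞}(E/K)`, `ε`-isotypic, killed by `2^M`, with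
`2^{k(M-d)} ≤ #B`. [cite: Kolyvagin1991MathAnn, §2 Thm. 2.2 (proof)] -/
theorem closure_of_triangularSystem {Q : Type} [AddCommGroup Q] {ε : ℤ} {M k d : ℕ}
    {η : Fin k → galH1Primary (W.baseChange K) 2}
    {φ : Fin k → (galH1Primary (W.baseChange K) 2 →+ Q)}
    (hSel : ∀ i, η i ∈ selmerGroupPInfty (W.baseChange K) 2) (hM : ∀ i, 2 ^ M • η i = 0)
    (hε : ∀ i, (isLiftOfAut_liftAut (sigmaQ K h2 hθ hc)).conjH1Primary W 2 (η i) = ε • η i)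
    (htri : ∀ i j : Fin k, j < i → φ j (η i) = 0)
    (hdiag : ∀ i : Fin k, 2 ^ (M - d) ≤ addOrderOf (φ i (η i))) :
    Finite (AddSubgroup.closure (Set.range η)) ∧
      AddSubgroup.closure (Set.range η) ≤ selmerGroupPInfty (W.baseChange K) 2 ∧
      (∀ b ∈ AddSubgroup.closure (Set.range η),
        (isLiftOfAut_liftAut (sigmaQ K h2 hθ hc)).conjH1Primary W 2 b = ε • b) ∧
      (∀ b ∈ AddSubgroup.closure (Set.range η), 2 ^ M • b = 0) ∧
      2 ^ (k * (M - d)) ≤ Nat.card (AddSubgroup.closure (Set.range η)) := by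
  haveI : Fact (Nat.Prime 2) := ⟨Nat.prime_two⟩
  haveI : (W.baseChange K).IsElliptic := by rw [baseChange]; infer_instance
  set S := selmerGroupPInfty (W.baseChange K) 2 with hS
  -- the finite subgroup `S ∩ H¹[2^M]` contains the closure
  set T : AddSubgroup (galH1Primary (W.baseChange K) 2) :=
    S ⊓ (galH1Primary (W.baseChange K) 2)[((2 ^ M : ℕ) : ℤ)] with hT
  have hle : AddSubgroup.closure (Set.range η) ≤ T := (AddSubgroup.closure_le _).mpr (by
    rintro _ ⟨i, rfl⟩
    exact mem_inf.mpr ⟨hSel i, torsionBy.nsmul_iff.mpr (hM i)⟩)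
  haveI : Finite S[((2 : ℕ) : ℤ)] := finite_torsionBy_selmerGroupPInfty (W.baseChange K) 2
  haveI : Finite S[((2 ^ M : ℕ) : ℤ)] := finite_torsionBy_pow _ 2 M
  haveI hTfin : Finite T := by
    refine Finite.of_injective (fun x : T ↦ (⟨⟨(x : galH1Primary (W.baseChange K) 2),
      (mem_inf.mp x.2).1⟩, torsionBy.nsmul_iff.mpr (Subtype.ext ?_)⟩ : S[((2 ^ M : ℕ) : ℤ)])) ?_
    · rw [AddSubmonoidClass.coe_nsmul, ZeroMemClass.coe_zero]
      exact torsionBy.nsmul_iff.mp (mem_inf.mp x.2).2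
    · intro x y hxy
      exact Subtype.ext (congrArg (fun z : S[((2 ^ M : ℕ) : ℤ)] ↦ ((z : S) : galH1Primary
        (W.baseChange K) 2)) hxy)
  have hfin : Finite (AddSubgroup.closure (Set.range η)) :=
    Finite.of_injective _ (inclusion_injective hle)
  refine ⟨hfin, hle.trans inf_le_left, fun b hb ↦ ?_, fun b hb ↦ ?_, ?_⟩
  · refine AddSubgroup.closure_induction (fun y hy ↦ ?_) (by rw [map_zero, zsmul_zero])
      (fun a b _ _ ha hb ↦ ?_) (fun a _ ha ↦ ?_) hb
    · obtain ⟨i, rfl⟩ := hy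
      exact hε i
    · rw [map_add, ha, hb, zsmul_add]
    · rw [map_neg, ha, zsmul_neg]
  · exact torsionBy.nsmul_iff.mp (mem_inf.mp (hle hb)).2
  · rw [mul_comm, pow_mul]
    exact pow_le_natCard_closure_of_triangular (2 ^ (M - d)) k η φ hfin htri hdiag

include h2 hθ hc in
/-- **The formal half of `stub_lowerBoundMinimalPosDepth`, assembled (S2+S3+S4).** If for one sign
`ε ∈ {1, -1}` and one defect `d`, `Sel_{2^∞}(E/K)` carries a triangular system (as in
`closure_of_triangularSystem`) of size `ν + 1` and level `M` for EVERY `M`, then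
`ν + 1 ≤ corank Sel_{2^∞}(E/ℚ)` or `ν + 1 ≤ corank Sel_{2^∞}(E^{(d_K)}/ℚ)`. What remains of the
stub (research content, Kolyvagin 1991 Thm. 2.2 / W. Zhang 2014 Lemma 8.4 at the prime `2`): the
Heegner-point classes `c_M(n_i)` at the minimal depth `ν` FORM such systems.
[cite: Kolyvagin1991MathAnn, §2 Thm. 2.2–2.3] -/
theorem lowerBound_of_triangularSystems (Q : ℕ → Type) [∀ M, AddCommGroup (Q M)] (ν d : ℕ)
    (ε : ℤ) (hε1 : ε = 1 ∨ ε = -1)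
    (h : ∀ M : ℕ, ∃ (η : Fin (ν + 1) → galH1Primary (W.baseChange K) 2)
        (φ : Fin (ν + 1) → (galH1Primary (W.baseChange K) 2 →+ Q M)),
      (∀ i, η i ∈ selmerGroupPInfty (W.baseChange K) 2) ∧ (∀ i, 2 ^ M • η i = 0) ∧
      (∀ i, (isLiftOfAut_liftAut (sigmaQ K h2 hθ hc)).conjH1Primary W 2 (η i) = ε • η i) ∧
      (∀ i j : Fin (ν + 1), j < i → φ j (η i) = 0) ∧
      (∀ i : Fin (ν + 1), 2 ^ (M - d) ≤ addOrderOf (φ i (η i)))) :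
    ν + 1 ≤ W.selmerCorank 2 ∨
      ν + 1 ≤ (W.quadraticTwist (NumberField.discr K : ℚ)).selmerCorank 2 := by
  -- growth with constant `2^{(ν+1)d}`
  have hgrow : ∀ M, ∃ B : AddSubgroup (galH1Primary (W.baseChange K) 2), Finite B ∧
      B ≤ selmerGroupPInfty (W.baseChange K) 2 ∧
      (∀ b ∈ B, (isLiftOfAut_liftAut (sigmaQ K h2 hθ hc)).conjH1Primary W 2 b = ε • b) ∧
      (∀ b ∈ B, 2 ^ M • b = 0) ∧ 2 ^ ((ν + 1) * M) ≤ 2 ^ ((ν + 1) * d) * Nat.card B := by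
    intro M
    obtain ⟨η, φ, hSel, hM, hε, htri, hdiag⟩ := h M
    obtain ⟨hfin, hle, hεB, hMB, hcard⟩ :=
      closure_of_triangularSystem W K h2 hθ hc hSel hM hε htri hdiag
    refine ⟨AddSubgroup.closure (Set.range η), hfin, hle, hεB, hMB, ?_⟩
    calc 2 ^ ((ν + 1) * M) ≤ 2 ^ ((ν + 1) * d + (ν + 1) * (M - d)) :=
          Nat.pow_le_pow_right (by norm_num)
            (by rw [← mul_add]; exact Nat.mul_le_mul_left _ (by omega))
      _ = 2 ^ ((ν + 1) * d) * 2 ^ ((ν + 1) * (M - d)) := pow_add _ _ _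
      _ ≤ 2 ^ ((ν + 1) * d) * Nat.card (AddSubgroup.closure (Set.range η)) :=
          Nat.mul_le_mul_left _ hcard
  rcases hε1 with rfl | rfl
  · refine lowerBound_of_eigenGrowthOverK W K h2 hθ hc ν (2 ^ ((ν + 1) * d)) (Or.inl fun M ↦ ?_)
    obtain ⟨B, h1, h2', h3, h4, h5⟩ := hgrow M
    exact ⟨B, h1, h2', fun b hb ↦ by rw [h3 b hb, one_zsmul], h4, h5⟩
  · refine lowerBound_of_eigenGrowthOverK W K h2 hθ hc ν (2 ^ ((ν + 1) * d)) (Or.inr fun M ↦ ?_)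
    obtain ⟨B, h1, h2', h3, h4, h5⟩ := hgrow M
    exact ⟨B, h1, h2', fun b hb ↦ by rw [h3 b hb, neg_one_zsmul], h4, h5⟩

end OverK

end Summit.BirchSwinnertonDyer.BirchSwinnertonDyer.Theorems.KolyvaginRankRigidity
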